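import Literature.IUT.HodgeArakelov.GaloisPairCyclotomesCor111GenuineOfHgalois
import Literature.IUT.HodgeArakelov.MonoThetaProjectiveNaturalSystemAtModelTate
import Literature.IUT.HodgeArakelov.BadPlaceSettingAtModelTate
import Literature.IUT.HodgeArakelov.ModelMonoThetaBaseDatumLim
import Literature.IUT.HodgeArakelov.AbsTopMonoidsGenuineOfSettingTempered
import Literature.AnabelianGeometry.EtaleTheta.SettingModelTateOrigin
import Literature.AnabelianGeometry.EtaleTheta.SettingModelTateThetaTopology
import Literature.AnabelianGeometry.EtaleTheta.SettingModelTateGroupLevel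
import HarnessLib

/-!
# [IUTchII] Cor. 1.10 / Cor. 1.11 AT THE [EtTh] TATE MODEL `ThetaSetting.modelTate p` — the `EtaleLevels` genuine chain
# instantiated with every class-R / printed binder a THEOREM (proof-only; D-0079 K-L6, row «COR110-111-AT-MODELTATE»)

S. Mochizuki, *Inter-universal Teichmüller theory II*, §1, Cor. 1.10 p. 47, Cor. 1.11 p. 49, kurims manuscript (Dec. 2020)
[claim: Mochizuki2012, status: disputed] (IUTchII §1 Cor 1.11, kurims p.49); [EtTh] = S. Mochizuki, Publ. RIMS **45** (2009),
§1 pp. 11–14, Cor. 2.18 (i) p. 60 (F-0620); [AbsTopIII] Cor. 1.10 pp. 41–44 ((HGAL)); [AbsAnab] Lem. 1.3.8 ((H1)).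
abc-iut cell, layer L6, nodes `IUTchII:Cor1.10` / `IUTchII:Cor1.11`; seat abc-iut-w4-d030 (gen 5; lineage of the `EtaleLevels`
natural system — bridge B8 part 5 — and of `GaloisPairCyclotomesCor111Genuine(OfHgalois)`), row «COR110-111-AT-MODELTATE»
(abc-iut-L6-lead §F v1.19ax (3)). File 3 over abc-iut-w5-d233's p453435 / p454733 and abc-iut-w4-d038's p454451 (the data of
record at the Tate model, consumed BY NAME). PROOF-ONLY: 0 definitions, no `Prop`-valued fact, nothing restated.

THE DATA (as in `ModelTateCarriers.naturalSystem_level_rows_modelTate`): `D := modelχq p 1 2` (= `modelTate p`; `K = ℚ_p`,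
`q_X = p²`), an odd prime `l` with `4l ∣ p − 1`, a compatible cyclotome tower `τ` (DATA, inhabited), `hC := compat_modelχq`,
`hS := modelχq_sec2Hyps`, the `inr`-section étale-theta datum of record carrying `η̈♯ = etaDdχq`, `X̲̲ := doubleUnderlineχqOfEtaRes`
(`Π^tp_{X̲̲} = Huuχq`), `h15 := prop15iii_etaleThetaDataOfClass_etaDdχq`, the EMPTY cusp labelling, `hO := modelχq_isEtThOrigin`,
`hYcl := hYcl_modelχq`, `hp2`/`hpl`/`hζ` from `4l ∣ p − 1`, the root cocycle `rootLift C` (abc-iut-w5-d233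
`rootLift_mem_rootCocycles`), `hZ := nonempty_lDeltaQuot_rigidData_mulEquiv_zHat … hO hYcl` (abc-iut-L2-d1 p415192).

* **`cor110_multiradiallyDefined_modelTate`** — [IUTchII] Cor. 1.10 AT THE GENUINE NATURAL SYSTEM OF THE TATE MODEL
  (`EtaleLevels.cor110_multiradiallyDefined_modelLim` instantiated): residual = F-0620 `Cor218_i` at level `1` ONLY (+ DATA `τ`).
* **`hq_setting_modelTate`** — (H2) «`Π^tp_{X̲̲}/Δ ⥲ G_K` topologically» at the `EtaleLevels` setting of the Tate model is a
  THEOREM (abc-iut-w5-d105/L6 `quotDeltaX_iso_ofDoubleUnderline_of_groupLevelData` over abc-iut-L2's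
  `nonempty_groupLevelData_curveχq_holds`).
* **`exists_cor111FunctorCor110_modelTate`** — [IUTchII] Cor. 1.11: the functor `ℛ → ℱ` over the GENUINE monoids
  `genuineOfModel (setting …) K.mlfClosure K.galoisEpsilon`, the genuine `Ẑ^×`-twist, the unconditional rigidity input and Cor. 1.10's
  genuine family EXISTS and is multiradially defined at the Tate model (this seat's p456211
  `…_of_hgalois_ownField_origin` instantiated, with `IsTateOrigin` := `modelχq_isTateOrigin`, `IsQuotientMap toTheta` :=
  `isQuotientMap_toTheta_modelχq`, `CompactSpace G_K` := `EtaleLevels.compactSpace_Gk`, (H2) := `hq_setting_modelTate`):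
  residual BY NAME = {F-0620 `Cor218_i` at every level, (H1) `hΔ` ([AbsAnab] Lem. 1.3.8 class), (HGAL) = [AbsTopIII] Cor. 1.10}
  — EXACTLY the FACT-class anabelian inputs, nothing else (+ DATA `τ`, `Γ`, `Γ'`).
K-L6 reading (with p453435 / p454733 / p454451): at ONE genuine (non-toy) carrier the [IUTchII] §1 chain Def 1.1 → Prop 1.2 →
Prop 1.5 → Cor 1.10 → Cor 1.11 is realised with every class-R clause and every printed side condition a theorem of the tree.
HONEST LABEL: `modelTate` is a SEMI-SYNTHETIC model of the typed [EtTh] §1 interface (not the tempered `π₁` of a curve):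
joint-satisfiability / binder-discharge evidence for the typed interface; the [IUTchII] claim key `Mochizuki2012` is DISPUTED and
nothing of it is asserted; nothing of [EtTh]/[AbsTopIII]/[AbsAnab] is asserted beyond the tree's proofs; (HGAL), (H1), F-0620 stay
hypotheses BY NAME; no side is taken on [IUTchIII] Cor. 3.12; typed ≠ proved; nothing here says abc is proved or refuted.
-/

noncomputable section

namespace Literature.IUT.HodgeArakelov

open CategoryTheory
open Literature.AnabelianGeometry.AbsoluteAnabelian
open Literature.AnabelianGeometry.EtaleTheta Literature.AnabelianGeometry.SemiGraphs
open Literature.AnabelianGeometry.EtaleTheta.SettingModel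
open scoped Literature.AnabelianGeometry.EtaleTheta

namespace ModelTateCarriers

variable (p : ℕ) [Fact p.Prime] (l : ℕ+) (hl : Odd (l : ℕ)) (hlp : (l : ℕ).Prime) (hdvd : 4 * (l : ℕ) ∣ p - 1)
  {Es : Set ℕ+} (τ : (ThetaSetting.modelχq p 1 2 even_two).CyclotomeTower l Es)

/-- **[IUTchII] Cor. 1.10 AT THE GENUINE NATURAL SYSTEM OF THE TATE MODEL**: for the functor `ℛ → ℱ` determined by Cor. 1.10's
genuine family `EtaleLevels.familyLim` of the natural system of `modelTate p` (data of record, every class-R / printed binder a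
theorem), "the resulting natural functor `Ψ_ℛ : ℛ → ℛ†` is multiradially defined" — residual = [EtTh] Cor. 2.18 (i) at level `1`
(F-0620) ONLY. [claim: Mochizuki2012, status: disputed] (IUTchII §1 Cor 1.10, kurims p.47) -/
theorem cor110_multiradiallyDefined_modelTate (Γxμ : Type) [Group Γxμ] :
    let hC := compat_modelχq p 1 2 even_two
    let hS := ThetaSetting.modelχq_sec2Hyps p 1 2 even_two
    let K₀ := (kummerCoreχq p 1 2 even_two).toKummerDataOfSection SemidirectProduct.inr (continuous_inrχq p 1 2)
        (fun _ => rfl) (map_inr_GK_le_GtpY_modelχq' p 1 2 even_two) (map_inr_GKdd_le_GtpYdd_modelχq' p 1 2 even_two)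
    let C := (K₀.etaleThetaDataOfClass (etaDdχq p 1 2 even_two)).doubleUnderlineχqOfEtaRes p 1 2 l hl
        (eta_res_etaDdχq p 1 2 even_two l hl)
    let h15 : Literature.AnabelianGeometry.EtaleTheta.ThetaSetting.Prop15iii _ hC :=
      prop15iii_etaleThetaDataOfClass_etaDdχq p hC SemidirectProduct.inr
        (continuous_inrχq p 1 2) (fun _ => rfl) (map_inr_GK_le_GtpY_modelχq' p 1 2 even_two)
        (map_inr_GKdd_le_GtpYdd_modelχq' p 1 2 even_two)
    let L : C.CuspLabels := ⟨fun _ => ∅, fun _ => ∅, fun _ => rfl⟩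
    let hO := ThetaSetting.modelχq_isEtThOrigin p 1 2 even_two
    let hYcl := hYcl_modelχq p 1 2 even_two
    let hp2 := ne_two_of_four_mul_dvd_pred p l.pos hdvd
    let hpl := ne_of_four_mul_dvd_pred p l.pos hdvd
    let hζ := exists_isPrimitiveRoot_K_modelχq p 1 2 even_two l.pos hdvd
    let hZ : ∀ M : ℕ+, Nonempty (ModelCyclotomes.lDeltaQuot (C.rigidData (τ.modAll M) hC hS h15 L) ≃*
        Literature.IUT.HodgeTheaters.ZHat) := fun M =>
      ModelCyclotomes.nonempty_lDeltaQuot_rigidData_mulEquiv_zHat C (τ.modAll M) hC hS h15 L hO hYcl hlp.ne_zero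
    ∀ h218i₁ : (EtaleLevels.levelRigid C hC hS τ.modAll h15 L 1).Cor218_i,
      ((ex18iii (EtaleLevels.setting C hC hS hlp hp2 hpl hζ τ.modAll (EtaleThetaDataOfSetting.rootLift C)
          (rootLift_mem_rootCocycles C hC)) Γxμ).toDagger
        (CategoryTheory.Prod.fst _ _ ⋙
          (EtaleLevels.familyLim C hC hS hlp hp2 hpl hζ τ.modAll (EtaleThetaDataOfSetting.rootLift C)
            (rootLift_mem_rootCocycles C hC) τ.red_modAll h15 L hZ h218i₁).toRigidityFunctor.Ξ)).IsMultiradiallyDefined := by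
  intro hC hS K₀ C h15 L hO hYcl hp2 hpl hζ hZ h218i₁
  exact EtaleLevels.cor110_multiradiallyDefined_modelLim C hC hS hlp hp2 hpl hζ τ.modAll _ _ τ.red_modAll h15 L hZ h218i₁ Γxμ

/-- **(H2) at the `EtaleLevels` setting of the Tate model is a THEOREM**: `Π^tp_{X̲̲}/Δ ⥲ G_K` as topological groups
(`quotDeltaX_iso_ofDoubleUnderline_of_groupLevelData` over abc-iut-L2's `nonempty_groupLevelData_curveχq_holds`: the stage-2
model is tempered, temp-slim and Galois-countable). [claim: Mochizuki2012, status: disputed] (IUTchII §1 Ex 1.8 (i), kurims p.35) -/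
theorem hq_setting_modelTate :
    let hC := compat_modelχq p 1 2 even_two
    let hS := ThetaSetting.modelχq_sec2Hyps p 1 2 even_two
    let K₀ := (kummerCoreχq p 1 2 even_two).toKummerDataOfSection SemidirectProduct.inr (continuous_inrχq p 1 2)
        (fun _ => rfl) (map_inr_GK_le_GtpY_modelχq' p 1 2 even_two) (map_inr_GKdd_le_GtpYdd_modelχq' p 1 2 even_two)
    let C := (K₀.etaleThetaDataOfClass (etaDdχq p 1 2 even_two)).doubleUnderlineχqOfEtaRes p 1 2 l hl
        (eta_res_etaDdχq p 1 2 even_two l hl)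
    let hp2 := ne_two_of_four_mul_dvd_pred p l.pos hdvd
    let hpl := ne_of_four_mul_dvd_pred p l.pos hdvd
    let hζ := exists_isPrimitiveRoot_K_modelχq p 1 2 even_two l.pos hdvd
    Nonempty (TopGroup.quot
        (EtaleLevels.setting C hC hS hlp hp2 hpl hζ τ.modAll (EtaleThetaDataOfSetting.rootLift C)
          (rootLift_mem_rootCocycles C hC)).PiX
        (EtaleLevels.setting C hC hS hlp hp2 hpl hζ τ.modAll (EtaleThetaDataOfSetting.rootLift C)
          (rootLift_mem_rootCocycles C hC)).DeltaX ≃ₜ*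
      (EtaleLevels.setting C hC hS hlp hp2 hpl hζ τ.modAll (EtaleThetaDataOfSetting.rootLift C)
          (rootLift_mem_rootCocycles C hC)).Gk) := by
  intro hC hS K₀ C hp2 hpl hζ
  obtain ⟨d⟩ := nonempty_groupLevelData_curveχq_holds p 1 2
  exact ThetaSetting.quotDeltaX_iso_ofDoubleUnderline_of_groupLevelData C (τ.modAll 1) hC hS hlp hp2 hpl hζ
    (EtaleLevels.eta0_mem C hC hS τ.modAll _ (rootLift_mem_rootCocycles C hC) 1) d

/-- **[IUTchII] Cor. 1.11 AT THE TATE MODEL** — the functor `ℛ → ℱ` over the GENUINE monoids `genuineOfModel (setting …)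
K.mlfClosure K.galoisEpsilon` (`K = ℚ_p`), the genuine `Ẑ^×`-twist, the unconditional rigidity input and Cor. 1.10's genuine family
`familyLim` EXISTS and is multiradially defined, for the data of record of `modelTate p` (every class-R clause and printed side
condition a theorem: `IsEtThOrigin`, `hYcl`, `IsTateOrigin`, `IsQuotientMap toTheta`, `Prop15iii`, `Sec2Hyps`, `Compat`, `ζ_{4l}`,
root cocycle, `hZ`, `CompactSpace G_K`, (H2)) — GRANTED EXACTLY: F-0620 `Cor218_i` at every level, (H1) `hΔ` («every topological
automorphism of `Π^tp_{X̲̲}` stabilises `Δ`», [AbsAnab] Lem. 1.3.8 class) and (HGAL) («every topological automorphism of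
`Π^tp_{X̲̲}` lies over an inner automorphism of `G_{ℚ_p}` on `G_K`», [AbsTopIII] Cor. 1.10). (= this seat's p456211
`EtaleLevels.exists_cor111FunctorCor110_familyLim_multiradiallyDefined_of_hgalois_ownField_origin` instantiated.)
[claim: Mochizuki2012, status: disputed] (IUTchII §1 Cor 1.11, kurims p.49) -/
theorem exists_cor111FunctorCor110_modelTate (Γ : Subgroup ZHatUnits) (Γ' : Type) [Group Γ'] :
    let hC := compat_modelχq p 1 2 even_two
    let hS := ThetaSetting.modelχq_sec2Hyps p 1 2 even_two
    let K₀ := (kummerCoreχq p 1 2 even_two).toKummerDataOfSection SemidirectProduct.inr (continuous_inrχq p 1 2)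
        (fun _ => rfl) (map_inr_GK_le_GtpY_modelχq' p 1 2 even_two) (map_inr_GKdd_le_GtpYdd_modelχq' p 1 2 even_two)
    let C := (K₀.etaleThetaDataOfClass (etaDdχq p 1 2 even_two)).doubleUnderlineχqOfEtaRes p 1 2 l hl
        (eta_res_etaDdχq p 1 2 even_two l hl)
    let h15 : Literature.AnabelianGeometry.EtaleTheta.ThetaSetting.Prop15iii _ hC :=
      prop15iii_etaleThetaDataOfClass_etaDdχq p hC SemidirectProduct.inr
        (continuous_inrχq p 1 2) (fun _ => rfl) (map_inr_GK_le_GtpY_modelχq' p 1 2 even_two)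
        (map_inr_GKdd_le_GtpYdd_modelχq' p 1 2 even_two)
    let L : C.CuspLabels := ⟨fun _ => ∅, fun _ => ∅, fun _ => rfl⟩
    let hO := ThetaSetting.modelχq_isEtThOrigin p 1 2 even_two
    let hYcl := hYcl_modelχq p 1 2 even_two
    let hp2 := ne_two_of_four_mul_dvd_pred p l.pos hdvd
    let hpl := ne_of_four_mul_dvd_pred p l.pos hdvd
    let hζ := exists_isPrimitiveRoot_K_modelχq p 1 2 even_two l.pos hdvd
    let f := EtaleThetaDataOfSetting.rootLift C
    let hf := rootLift_mem_rootCocycles C hC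
    let hZ : ∀ M : ℕ+, Nonempty (ModelCyclotomes.lDeltaQuot (C.rigidData (τ.modAll M) hC hS h15 L) ≃*
        Literature.IUT.HodgeTheaters.ZHat) := fun M =>
      ModelCyclotomes.nonempty_lDeltaQuot_rigidData_mulEquiv_zHat C (τ.modAll M) hC hS h15 L hO hYcl hlp.ne_zero
    let hq : Nonempty (TopGroup.quot (EtaleLevels.setting C hC hS hlp hp2 hpl hζ τ.modAll f hf).PiX
        (EtaleLevels.setting C hC hS hlp hp2 hpl hζ τ.modAll f hf).DeltaX ≃ₜ*
          (EtaleLevels.setting C hC hS hlp hp2 hpl hζ τ.modAll f hf).Gk) :=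
      hq_setting_modelTate p l hl hlp hdvd τ
    haveI : CompactSpace (EtaleLevels.setting C hC hS hlp hp2 hpl hζ τ.modAll f hf).Gk :=
      EtaleLevels.compactSpace_Gk C hC hS hlp hp2 hpl hζ τ.modAll f hf
    ∀ (h218i : ∀ M : ℕ+, (EtaleLevels.levelRigid C hC hS τ.modAll h15 L M).Cor218_i)
      (hΔ : ∀ g : (EtaleLevels.setting C hC hS hlp hp2 hpl hζ τ.modAll f hf).PiX ≃ₜ*
          (EtaleLevels.setting C hC hS hlp hp2 hpl hζ τ.modAll f hf).PiX,
        (EtaleLevels.setting C hC hS hlp hp2 hpl hζ τ.modAll f hf).DeltaX.map g.toMulEquiv.toMonoidHom =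
          (EtaleLevels.setting C hC hS hlp hp2 hpl hζ τ.modAll f hf).DeltaX)
      (hHGAL : ∀ α : (EtaleThetaDataOfSetting.Pi C) ≃ₜ* (EtaleThetaDataOfSetting.Pi C),
        ∃ σ : GQp p, ∀ x : EtaleThetaDataOfSetting.Pi C,
          EtaleThetaDataOfSetting.aug C (α x) = σ * EtaleThetaDataOfSetting.aug C x * σ⁻¹),
      ∃ (R : GalRigidityInput
          (AbsTopMonoids.genuineOfModel (EtaleLevels.setting C hC hS hlp hp2 hpl hζ τ.modAll f hf)
            (ThetaSetting.modelχq p 1 2 even_two).toTemperedCurve.mlfClosure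
            (ThetaSetting.modelχq p 1 2 even_two).toTemperedCurve.galoisEpsilon hΔ hq))
        (I : GalCorPiXInput
          (AbsTopMonoids.genuineOfModel (EtaleLevels.setting C hC hS hlp hp2 hpl hζ τ.modAll f hf)
            (ThetaSetting.modelχq p 1 2 even_two).toTemperedCurve.mlfClosure
            (ThetaSetting.modelχq p 1 2 even_two).toTemperedCurve.galoisEpsilon hΔ hq)
          (EtaleLevels.familyLim C hC hS hlp hp2 hpl hζ τ.modAll f hf τ.red_modAll h15 L hZ (h218i 1))),
        ((ex18iii (EtaleLevels.setting C hC hS hlp hp2 hpl hζ τ.modAll f hf) Γ').toDagger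
          (cor111FunctorCor110 (GalTwistInput.ofZHat (EtaleLevels.setting C hC hS hlp hp2 hpl hζ τ.modAll f hf)) R
            (EtaleLevels.familyLim C hC hS hlp hp2 hpl hζ τ.modAll f hf τ.red_modAll h15 L hZ (h218i 1)) I Γ Γ')).IsMultiradiallyDefined := by
  intro hC hS K₀ C h15 L hO hYcl hp2 hpl hζ f hf hZ hq h218i hΔ hHGAL
  haveI := EtaleLevels.compactSpace_Gk C hC hS hlp hp2 hpl hζ τ.modAll f hf
  exact EtaleLevels.exists_cor111FunctorCor110_familyLim_multiradiallyDefined_of_hgalois_ownField_origin C hC hS hlp hp2 hpl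
    hζ τ.modAll f hf τ.red_modAll h15 L hO hYcl (modelχq_isTateOrigin p 1) (isQuotientMap_toTheta_modelχq p 1 2 even_two)
    h218i hΔ hq hHGAL Γ Γ'

end ModelTateCarriers

end Literature.IUT.HodgeArakelov

end
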